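import Mathlib.RingTheory.SimpleModule.Basic
import Mathlib.LinearAlgebra.Projection
import Literature.Algebra.Module.Uniserial
import HarnessLib

/-!
# Non-split extensions of length two: an atom-and-coatom without complement is the ONLY proper element («LENGTH-TWO LATTICE»)

Generic lattice ∕ module theory, Mathlib-only, THEOREMS ONLY (no `def`, no instance, no named fact).

* §1 LATTICE CORE (any bounded lattice, no modularity): if `N` is an ATOM and a COATOM and has NO complement, then every element is
  `⊥`, `N` or `⊤` (`eq_bot_or_eq_or_eq_top_of_isAtom_isCoatom`); conversely the trichotomy makes any `P ∉ {⊥, ⊤}` equal to `N`.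
* §2 MODULES over any ring `R`: for a submodule `N ≤ M` with `N` and `M ⧸ N` SIMPLE (Mathlib `isSimpleModule_iff_isAtom ∕ _isCoatom`)
  and NO complement («the extension `0 → N → M → M⧸N → 0` is NON-SPLIT»): trichotomy of submodules (`Submodule.eq_bot_or_eq_or_eq_top_of_nonsplit`),
  `M` is neither simple nor semisimple, a non-zero map from a SIMPLE module into `M` has range exactly `N`
  (`range_eq_of_isSimpleModule`), and a map out of `M` is injective, kills `N`, or is zero — in particular it is INJECTIVE as soon as it
  does not vanish on `N` (`ker_eq_bot_of_not_le_ker`).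
* §3 «`M ≅ W ⧸ C`»: an injective `φ : M → W` whose range is a complement of `C ≤ W` induces `M ≃ₗ[R] W ⧸ C` through `mkQ ∘ φ`
  (`exists_linearEquiv_quotient_of_isCompl`, Mathlib `LinearEquiv.ofInjective` + `Submodule.quotientEquivOfIsCompl` with the commuting
  triangle recorded) — the bookkeeping by which a length-two module embedded in a longer one transversally to `C` is identified with a
  subquotient.
* §4 BRIDGE to the tree's `SocleRadical.IsUniserial` (`Literature.Algebra.Module.Uniserial`: «any two submodules are comparable»): a
  non-split extension of two simple modules IS uniserial (`isUniserial_of_nonsplit`), so that file's API (unique atom ∕ coatom = socle ∕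
  radical, the socle series is the composition series, …) applies; conversely in a uniserial module no proper non-trivial submodule has
  a complement (`not_isCompl_of_isUniserial`).
Since `R` is arbitrary these apply verbatim to `k[G]`-modules ∕ Hecke-algebra modules, i.e. to (smooth) representations.

SOURCES (what is formalised, read at our letters).  N. Bourbaki, *Algebra II* (Chapters 4–7), Ch. VII is not needed; the relevant
print locus is *Algèbre* Ch. II §1 no. 9 (split exact sequences: a submodule is a direct factor iff it has a supplement, Prop. 15 and
Cor. 1) [BourbakiAlgebre1a3] — §2's «non-split» is exactly «no supplement», and §3 is Cor. 1 («`Im v` is a supplement of `Ker u`» ⇒ the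
supplement maps isomorphically onto the quotient); the atom∕coatom trichotomy of §1 is the two-step case of the Jordan–Hölder
uniqueness for a UNISERIAL module [AndersonFuller1992, §32: «any two submodules are comparable», Lemma 32.1], and §4 says so in the
tree's vocabulary.  Deliberately NOT here: Jordan–Hölder series, lengths, `Ext`.
-/

set_option autoImplicit false

namespace Literature.Algebra.Module

/-! ## §1 Lattice core: atom + coatom + no complement ⇒ trichotomy -/

section Lattice

variable {α : Type*} [Lattice α] [BoundedOrder α]

/-- **TRICHOTOMY.**  In a bounded lattice, if `N` is an atom and a coatom and has no complement, then every `P` is `⊥`, `N` or `⊤`: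
`P ⊓ N ∈ {⊥, N}` (atom); if `N ≤ P` then `P ∈ {N, ⊤}` (coatom); if `P ⊓ N = ⊥` then `P ⊔ N ∈ {N, ⊤}` (coatom) gives `P ≤ N` (so `P = ⊥`) or
a complement.  No modularity is used. [cite: BourbakiAlgebre1a3, Ch. II §1 no. 9 Prop. 15] -/
theorem eq_bot_or_eq_or_eq_top_of_isAtom_isCoatom {N : α} (hN : IsAtom N) (hN' : IsCoatom N) (hnc : ∀ P, ¬ IsCompl N P)
    (P : α) : P = ⊥ ∨ P = N ∨ P = ⊤ := by
  rcases hN.le_iff.mp (inf_le_right : P ⊓ N ≤ N) with h | h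
  · -- `P ⊓ N = ⊥`
    rcases hN'.le_iff.mp (le_sup_right : N ≤ P ⊔ N) with h' | h'
    · exact absurd (IsCompl.of_eq (by rwa [inf_comm] at h) (by rwa [sup_comm] at h')) (hnc P)
    · -- `P ⊔ N = N`, so `P ≤ N`, so `P = P ⊓ N = ⊥`
      left
      rw [← h]
      exact (inf_eq_left.mpr (sup_eq_right.mp h')).symm
  · -- `P ⊓ N = N`, so `N ≤ P`
    rcases hN'.le_iff.mp (inf_eq_right.mp h) with h' | h'
    · exact Or.inr (Or.inr h')
    · exact Or.inr (Or.inl h')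

/-- The proper non-trivial element is UNIQUE: any `P ≠ ⊥, ⊤` equals `N`. [cite: BourbakiAlgebre1a3, Ch. II §1 no. 9 Prop. 15] -/
theorem eq_of_ne_bot_of_ne_top_of_isAtom_isCoatom {N : α} (hN : IsAtom N) (hN' : IsCoatom N) (hnc : ∀ P, ¬ IsCompl N P)
    {P : α} (hb : P ≠ ⊥) (ht : P ≠ ⊤) : P = N := by
  rcases eq_bot_or_eq_or_eq_top_of_isAtom_isCoatom hN hN' hnc P with h | h | h
  · exact absurd h hb
  · exact h
  · exact absurd h ht

/-- Under the trichotomy, `N` is comparable with everything: `P ≤ N ∨ N ≤ P`. [cite: BourbakiAlgebre1a3, Ch. II §1 no. 9 Prop. 15] -/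
theorem le_or_ge_of_isAtom_isCoatom {N : α} (hN : IsAtom N) (hN' : IsCoatom N) (hnc : ∀ P, ¬ IsCompl N P) (P : α) :
    P ≤ N ∨ N ≤ P := by
  rcases eq_bot_or_eq_or_eq_top_of_isAtom_isCoatom hN hN' hnc P with rfl | rfl | rfl
  · exact Or.inl bot_le
  · exact Or.inl le_rfl
  · exact Or.inr le_top

end Lattice

/-! ## §2 Modules: a non-split extension of a simple module by a simple module -/

section Module

variable {R : Type*} [Ring R] {M : Type*} [AddCommGroup M] [Module R M]

/-- **TRICHOTOMY OF SUBMODULES.**  If `N` and `M ⧸ N` are simple and `N` has no complement (the extension `0 → N → M → M⧸N → 0` does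
NOT split), then every submodule of `M` is `⊥`, `N` or `⊤`. [cite: BourbakiAlgebre1a3, Ch. II §1 no. 9 Prop. 15] -/
theorem Submodule.eq_bot_or_eq_or_eq_top_of_nonsplit (N : Submodule R M) [IsSimpleModule R N] [IsSimpleModule R (M ⧸ N)]
    (hnc : ∀ P : Submodule R M, ¬ IsCompl N P) (P : Submodule R M) : P = ⊥ ∨ P = N ∨ P = ⊤ :=
  eq_bot_or_eq_or_eq_top_of_isAtom_isCoatom ((isSimpleModule_iff_isAtom).mp ‹_›) ((isSimpleModule_iff_isCoatom).mp ‹_›) hnc P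

/-- Uniqueness of the proper non-trivial submodule. [cite: BourbakiAlgebre1a3, Ch. II §1 no. 9 Prop. 15] -/
theorem Submodule.eq_of_ne_bot_of_ne_top_of_nonsplit (N : Submodule R M) [IsSimpleModule R N] [IsSimpleModule R (M ⧸ N)]
    (hnc : ∀ P : Submodule R M, ¬ IsCompl N P) {P : Submodule R M} (hb : P ≠ ⊥) (ht : P ≠ ⊤) : P = N :=
  eq_of_ne_bot_of_ne_top_of_isAtom_isCoatom ((isSimpleModule_iff_isAtom).mp ‹_›) ((isSimpleModule_iff_isCoatom).mp ‹_›) hnc hb ht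

/-- `M` itself is NOT simple (it has the proper non-trivial submodule `N`). [cite: BourbakiAlgebre1a3, Ch. II §1 no. 9 Prop. 15] -/
theorem not_isSimpleModule_of_nonsplit (N : Submodule R M) [IsSimpleModule R N] [IsSimpleModule R (M ⧸ N)] :
    ¬ IsSimpleModule R M := by
  intro h
  have hA : IsAtom N := (isSimpleModule_iff_isAtom).mp ‹_›
  have hC : IsCoatom N := (isSimpleModule_iff_isCoatom).mp ‹_›
  rcases h.toIsSimpleOrder.eq_bot_or_eq_top N with h' | h'
  · exact hA.1 h'
  · exact hC.1 h'

/-- `M` is NOT semisimple: in a semisimple module every submodule has a complement. [cite: BourbakiAlgebre1a3, Ch. II §1 no. 9 Prop. 15] -/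
theorem not_isSemisimpleModule_of_nonsplit (N : Submodule R M) (hnc : ∀ P : Submodule R M, ¬ IsCompl N P) :
    ¬ IsSemisimpleModule R M := by
  intro h
  obtain ⟨P, hP⟩ := h.toComplementedLattice.exists_isCompl N
  exact hnc P hP

/-- **A NON-ZERO MAP FROM A SIMPLE MODULE LANDS EXACTLY ON `N`.**  For `S` simple and `f : S → M` non-zero, `range f = N`: the range is
`⊥`, `N` or `⊤`; not `⊥` since `f ≠ 0`; not `⊤` since then `M ≅ S ∕ ker f` would be simple. [cite: BourbakiAlgebre1a3, Ch. II §1 no. 9 Prop. 15] -/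
theorem range_eq_of_isSimpleModule (N : Submodule R M) [IsSimpleModule R N] [IsSimpleModule R (M ⧸ N)]
    (hnc : ∀ P : Submodule R M, ¬ IsCompl N P) {S : Type*} [AddCommGroup S] [Module R S] [IsSimpleModule R S]
    (f : S →ₗ[R] M) (hf : f ≠ 0) : LinearMap.range f = N := by
  refine Submodule.eq_of_ne_bot_of_ne_top_of_nonsplit N hnc ?_ ?_
  · rwa [Ne, LinearMap.range_eq_bot]
  · intro htop
    -- `f` is surjective; its kernel is `⊥` (else `f = 0`), so `f` is an isomorphism and `M` is simple
    have hker : LinearMap.ker f = ⊥ := by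
      rcases IsSimpleOrder.eq_bot_or_eq_top (LinearMap.ker f) with h | h
      · exact h
      · exact absurd (LinearMap.ker_eq_top.mp h) hf
    have e : S ≃ₗ[R] M :=
      LinearEquiv.ofBijective f ⟨LinearMap.ker_eq_bot.mp hker, LinearMap.range_eq_top.mp htop⟩
    exact not_isSimpleModule_of_nonsplit N (e.isSimpleModule_iff.mp ‹_›)

/-- **A MAP OUT OF `M` IS INJECTIVE, KILLS `N`, OR IS ZERO** (its kernel is `⊥`, `N` or `⊤`).
[cite: BourbakiAlgebre1a3, Ch. II §1 no. 9 Prop. 15] -/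
theorem ker_eq_bot_or_eq_or_eq_zero (N : Submodule R M) [IsSimpleModule R N] [IsSimpleModule R (M ⧸ N)]
    (hnc : ∀ P : Submodule R M, ¬ IsCompl N P) {M' : Type*} [AddCommGroup M'] [Module R M'] (g : M →ₗ[R] M') :
    LinearMap.ker g = ⊥ ∨ LinearMap.ker g = N ∨ g = 0 := by
  rcases Submodule.eq_bot_or_eq_or_eq_top_of_nonsplit N hnc (LinearMap.ker g) with h | h | h
  · exact Or.inl h
  · exact Or.inr (Or.inl h)
  · exact Or.inr (Or.inr (LinearMap.ker_eq_top.mp h))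

/-- In particular a map out of `M` that does NOT vanish identically on `N` is INJECTIVE.
[cite: BourbakiAlgebre1a3, Ch. II §1 no. 9 Prop. 15] -/
theorem ker_eq_bot_of_not_le_ker (N : Submodule R M) [IsSimpleModule R N] [IsSimpleModule R (M ⧸ N)]
    (hnc : ∀ P : Submodule R M, ¬ IsCompl N P) {M' : Type*} [AddCommGroup M'] [Module R M'] (g : M →ₗ[R] M')
    (hg : ¬ N ≤ LinearMap.ker g) : LinearMap.ker g = ⊥ := by
  rcases ker_eq_bot_or_eq_or_eq_zero N hnc g with h | h | h
  · exact h
  · exact absurd h.ge hg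
  · exact absurd (by rw [h, LinearMap.ker_zero]; exact le_top) hg

/-- The image of `N` under an injective map out of `M` is the image of the unique proper submodule: for `g` injective and any proper
non-trivial `P ≤ M`, `P.map g = N.map g`. [cite: BourbakiAlgebre1a3, Ch. II §1 no. 9 Prop. 15] -/
theorem map_eq_map_of_nonsplit (N : Submodule R M) [IsSimpleModule R N] [IsSimpleModule R (M ⧸ N)]
    (hnc : ∀ P : Submodule R M, ¬ IsCompl N P) {M' : Type*} [AddCommGroup M'] [Module R M'] (g : M →ₗ[R] M')
    {P : Submodule R M} (hb : P ≠ ⊥) (ht : P ≠ ⊤) : P.map g = N.map g := by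
  rw [Submodule.eq_of_ne_bot_of_ne_top_of_nonsplit N hnc hb ht]

end Module

/-! ## §3 An injective map transversal to `C` identifies `M` with `W ⧸ C` -/

section Quotient

variable {R : Type*} [Ring R] {M W : Type*} [AddCommGroup M] [Module R M] [AddCommGroup W] [Module R W]

/-- **`M ≅ W ⧸ C` THROUGH `mkQ ∘ φ`.**  If `φ : M → W` is injective and its range is a complement of `C` (`range φ ⊓ C = ⊥`,
`range φ ⊔ C = ⊤`), then `m ↦ [φ m]` is a linear isomorphism `M ≃ W ⧸ C`. [cite: BourbakiAlgebre1a3, Ch. II §1 no. 9 Prop. 15 and Cor. 1] -/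
theorem exists_linearEquiv_quotient_of_isCompl (φ : M →ₗ[R] W) (hφ : Function.Injective φ) (C : Submodule R W)
    (hC : IsCompl C (LinearMap.range φ)) :
    ∃ e : M ≃ₗ[R] W ⧸ C, ∀ m, e m = C.mkQ (φ m) := by
  refine ⟨(LinearEquiv.ofInjective φ hφ).trans (Submodule.quotientEquivOfIsCompl C (LinearMap.range φ) hC).symm, fun m => ?_⟩
  rw [LinearEquiv.trans_apply, Submodule.quotientEquivOfIsCompl_symm_apply]
  rfl

/-- The transversality hypotheses in `inf ∕ sup` form: `range φ ⊓ C = ⊥` and `range φ ⊔ C = ⊤` give the isomorphism `M ≃ W ⧸ C`.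
[cite: BourbakiAlgebre1a3, Ch. II §1 no. 9 Prop. 15 and Cor. 1] -/
theorem exists_linearEquiv_quotient_of_inf_eq_bot_of_sup_eq_top (φ : M →ₗ[R] W) (hφ : Function.Injective φ)
    (C : Submodule R W) (hinf : LinearMap.range φ ⊓ C = ⊥) (hsup : LinearMap.range φ ⊔ C = ⊤) :
    ∃ e : M ≃ₗ[R] W ⧸ C, ∀ m, e m = C.mkQ (φ m) :=
  exists_linearEquiv_quotient_of_isCompl φ hφ C (IsCompl.of_eq (by rwa [inf_comm]) (by rwa [sup_comm]))

end Quotient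

/-! ## §4 Bridge to `SocleRadical.IsUniserial` -/

section Uniserial

variable {R : Type*} [Ring R] {M : Type*} [AddCommGroup M] [Module R M]

/-- **A NON-SPLIT EXTENSION OF TWO SIMPLE MODULES IS UNISERIAL** in the sense of the tree's `SocleRadical.IsUniserial` (any two
submodules are comparable): by the trichotomy every submodule is `⊥`, `N` or `⊤`. [cite: AndersonFuller1992, §32 (before Lemma 32.1)] -/
theorem isUniserial_of_nonsplit (N : Submodule R M) [IsSimpleModule R N] [IsSimpleModule R (M ⧸ N)]
    (hnc : ∀ P : Submodule R M, ¬ IsCompl N P) : SocleRadical.IsUniserial R M := by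
  refine ⟨fun P Q => ?_⟩
  rcases Submodule.eq_bot_or_eq_or_eq_top_of_nonsplit N hnc P with hP | hP | hP
  · exact Or.inl (hP ▸ bot_le)
  · rcases Submodule.eq_bot_or_eq_or_eq_top_of_nonsplit N hnc Q with hQ | hQ | hQ
    · exact Or.inr (hQ ▸ bot_le)
    · exact Or.inl (hP.trans hQ.symm).le
    · exact Or.inl (hQ ▸ le_top)
  · exact Or.inr (hP ▸ le_top)

/-- Conversely, in a UNISERIAL module no proper non-trivial submodule has a complement: a complement `P` of `N` is comparable with `N`,
and `P ≤ N` forces `P = ⊥`, `N = ⊤`, while `N ≤ P` forces `N = ⊥`. [cite: AndersonFuller1992, §32 (before Lemma 32.1)] -/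
theorem not_isCompl_of_isUniserial (h : SocleRadical.IsUniserial R M) {N : Submodule R M} (hb : N ≠ ⊥) (ht : N ≠ ⊤)
    (P : Submodule R M) : ¬ IsCompl N P := by
  intro hc
  rcases h.le_total P N with hle | hle
  · have hP : P = ⊥ := by
      have := hc.disjoint.eq_bot
      rwa [inf_eq_right.mpr hle] at this
    apply ht
    have := hc.codisjoint.eq_top
    rwa [hP, sup_bot_eq] at this
  · apply hb
    have := hc.disjoint.eq_bot
    rwa [inf_eq_left.mpr hle] at this

/-- Hence for `N` simple with simple quotient: NON-SPLIT ⟺ UNISERIAL. [cite: AndersonFuller1992, §32 Lemma 32.1] -/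
theorem isUniserial_iff_nonsplit (N : Submodule R M) [IsSimpleModule R N] [IsSimpleModule R (M ⧸ N)] :
    SocleRadical.IsUniserial R M ↔ ∀ P : Submodule R M, ¬ IsCompl N P :=
  ⟨fun h P => not_isCompl_of_isUniserial h ((isSimpleModule_iff_isAtom).mp ‹_›).1
      ((isSimpleModule_iff_isCoatom).mp ‹_›).1 P,
    fun hnc => isUniserial_of_nonsplit N hnc⟩

end Uniserial

end Literature.Algebra.Module
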